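import Literature.Topology.FourManifolds.MorseBirthInsertion
import Literature.Topology.FourManifolds.MorseProofs
import HarnessLib

/-!
# Stabilising an ordered Morse function on a closed `3`-manifold (the Heegaard stabilisation as a birth)

Topic `Literature/Topology/FourManifolds`; infrastructure for the fact seat
`provefact-Literature.Topology.FourManifolds.exists_isBalancedGKTrisection` (Gay–Kirby 2016,
Thm. 4 via §4: the proof stabilises the Heegaard splitting of `∂X₁`; in the trisection this is
the stabilisation of type `2`, `(g; k₁, k₂, k₃) ↦ (g + 1; k₁, k₂ + 1, k₃)`, Gay–Kirby Def. 8 /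
Lemma 10).  Everything in this file is **proved**; no definitions, no named facts.

`IsMorse.exists_ordered_birth`: let `φ` be a Morse function with values in `(0, 1)` on a closed
`3`-manifold, ordered at a regular level `b` (critical points below `b` have index `≤ 1`, above
`b` index `≥ 2`), and `W` an open set containing a point of the level `b`.  Then there are a
Morse function `φ'` and a regular level `b'` with the same properties, `φ' = φ` off `W`, with
the same critical points of index `0` and `3` and **exactly one more critical point of index
`1` and one more of index `2`** (so that the handlebodies `{φ' ≤ b'}`, `{b' ≤ φ'}` have genus one
more than `{φ ≤ b}`, `{b ≤ φ}`).  Proof: Milnor's insertion of a pair of auxiliary critical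
points of indices `1, 2` (Milnor 1965, Lemma 8.2 and proof of Thm. 8.1,
`IsMorse.exists_insert_birthPair`) near the point of the level inside `W`, with `ε` so small
that the two new critical values straddle a new regular level `b'` inside the gap of the old
critical values around `b`.

## References

* J. Milnor, *Lectures on the h-cobordism theorem* (1965), Lemma 8.2, proof of Thm. 8.1.
  [MilnorHCobordism1965]
* D. Gay, R. Kirby, *Trisecting 4-manifolds*, Geom. Topol. 20 (2016), Def. 8, Lemma 10, §4.
  [GayKirby2016]
-/

open scoped Manifold ContDiff Topology
open Set Function Filter

noncomputable section

universe u

namespace Literature.Topology.FourManifolds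

variable {Y : Type u} [TopologicalSpace Y] [T2Space Y] [CompactSpace Y]
  [ChartedSpace (EuclideanSpace ℝ (Fin 3)) Y] [IsManifold (𝓡 3) ∞ Y]

/-- **Heegaard stabilisation of an ordered Morse function, as a birth of a cancelling pair of
indices `1, 2` at the splitting level.** [cite: MilnorHCobordism1965, Lemma 8.2 and proof of Thm. 8.1 (PDF pp. 54–56)]
[cite: GayKirby2016, Def. 8 and Lemma 10; §4, proof of Thm. 4] -/
theorem IsMorse.exists_ordered_birth {φ : Y → ℝ} (hφ : IsMorse (𝓡 3) φ)
    (h01 : ∀ y, φ y ∈ Ioo 0 1) {b : ℝ}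
    (hbreg : ∀ z, IsMCriticalPt (𝓡 3) φ z → φ z ≠ b)
    (hbelow : ∀ z, IsMCriticalPt (𝓡 3) φ z → φ z < b → morseIndex (𝓡 3) φ z ≤ 1)
    (habove : ∀ z, IsMCriticalPt (𝓡 3) φ z → b < φ z → 2 ≤ morseIndex (𝓡 3) φ z)
    {W : Set Y} (hW : IsOpen W) {z₀ : Y} (hz₀ : z₀ ∈ W) (hz₀b : φ z₀ = b) :
    ∃ (φ' : Y → ℝ) (b' : ℝ), IsMorse (𝓡 3) φ' ∧ (∀ y, φ' y ∈ Ioo 0 1) ∧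
      (∀ z, IsMCriticalPt (𝓡 3) φ' z → φ' z ≠ b') ∧
      (∀ z, IsMCriticalPt (𝓡 3) φ' z → φ' z < b' → morseIndex (𝓡 3) φ' z ≤ 1) ∧
      (∀ z, IsMCriticalPt (𝓡 3) φ' z → b' < φ' z → 2 ≤ morseIndex (𝓡 3) φ' z) ∧
      (∀ y ∉ W, φ' y = φ y) ∧
      criticalSetOfIndex (𝓡 3) φ' 0 = criticalSetOfIndex (𝓡 3) φ 0 ∧
      criticalSetOfIndex (𝓡 3) φ' 3 = criticalSetOfIndex (𝓡 3) φ 3 ∧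
      (criticalSetOfIndex (𝓡 3) φ' 1).ncard = (criticalSetOfIndex (𝓡 3) φ 1).ncard + 1 ∧
      (criticalSetOfIndex (𝓡 3) φ' 2).ncard = (criticalSetOfIndex (𝓡 3) φ 2).ncard + 1 := by
  classical
  have hcont : Continuous φ := hφ.contMDiff.continuous
  have hfin : (criticalSet (𝓡 3) φ).Finite := IsMorse.finite_criticalSet_holds hφ
  -- a gap `d` around `b` free of critical values
  obtain ⟨d, hd0, hd⟩ : ∃ d > 0, ∀ x ∈ criticalSet (𝓡 3) φ, d ≤ |φ x - b| := by
    by_cases hne : (criticalSet (𝓡 3) φ).Nonempty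
    · obtain ⟨x₀, hx₀, hmin⟩ := (criticalSet (𝓡 3) φ).exists_min_image (fun x => |φ x - b|) hfin hne
      exact ⟨|φ x₀ - b|, abs_pos.2 (sub_ne_zero.2 (hbreg x₀ hx₀)), fun x hx => hmin x hx⟩
    · exact ⟨1, one_pos, fun x hx => absurd ⟨x, hx⟩ hne⟩
  -- margins for the values in `(0, 1)`
  obtain ⟨ymin, -, hymin⟩ := isCompact_univ.exists_isMinOn ⟨z₀, mem_univ _⟩ hcont.continuousOn
  obtain ⟨ymax, -, hymax⟩ := isCompact_univ.exists_isMaxOn ⟨z₀, mem_univ _⟩ hcont.continuousOn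
  have hm0 : 0 < φ ymin := (h01 ymin).1
  have hm1 : φ ymax < 1 := (h01 ymax).2
  set ε : ℝ := min (d / 8) (min (φ ymin / 2) ((1 - φ ymax) / 2)) with hεdef
  have hε : 0 < ε := by positivity
  have hεd : ε ≤ d / 8 := min_le_left _ _
  have hε0 : ε ≤ φ ymin / 2 := (min_le_right _ _).trans (min_le_left _ _)
  have hε1 : ε ≤ (1 - φ ymax) / 2 := (min_le_right _ _).trans (min_le_right _ _)
  -- the neighbourhood of `z₀` in which the pair is born
  set U : Set Y := W ∩ {y | |φ y - b| < ε} with hU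
  have hUo : IsOpen U := hW.inter (isOpen_lt (hcont.sub continuous_const).abs continuous_const)
  have hz₀U : z₀ ∈ U := ⟨hz₀, by simp [hz₀b, hε]⟩
  have hreg₀ : ¬ IsMCriticalPt (𝓡 3) φ z₀ := fun h => hbreg z₀ h hz₀b
  have hint₀ : (𝓡 3).IsInteriorPoint z₀ := BoundarylessManifold.isInteriorPoint
  obtain ⟨g, hgM, ⟨K, -, hKU, -, hgK⟩, hclose, hev, hidx, q, r, hqU, hrU, hqr, hq, hr, hcrit, hiq,
    hir, hlt⟩ := hφ.exists_insert_birthPair hint₀ hreg₀ (hUo.mem_nhds hz₀U) (k := 1) (by norm_num) hε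
  set b' : ℝ := (g q + g r) / 2 with hb'
  -- values at the old critical points are unchanged
  have hgold : ∀ x ∈ criticalSet (𝓡 3) φ, g x = φ x := fun x hx => (hev x hx).eq_of_nhds
  -- the new critical values lie within `2ε` of `b`
  have hnew : ∀ y ∈ U, |g y - b| < 2 * ε := fun y hy => by
    have h1 := hclose y
    have h2 : |φ y - b| < ε := hy.2
    calc |g y - b| = |(g y - φ y) + (φ y - b)| := by ring_nf
      _ ≤ |g y - φ y| + |φ y - b| := abs_add_le _ _
      _ < 2 * ε := by linarith
  have hqb := abs_lt.1 (hnew q hqU)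
  have hrb := abs_lt.1 (hnew r hrU)
  have hb'q : g q < b' := by rw [hb']; linarith
  have hb'r : b' < g r := by rw [hb']; linarith
  have hb'b : |b' - b| < 2 * ε := by rw [abs_lt]; constructor <;> [rw [hb']; rw [hb']] <;> linarith
  -- membership in the new critical set
  have hmem : ∀ z, IsMCriticalPt (𝓡 3) g z ↔ z = q ∨ z = r ∨ IsMCriticalPt (𝓡 3) φ z := fun z => by
    change z ∈ criticalSet (𝓡 3) g ↔ _
    rw [hcrit]
    simp [criticalSet]
  -- old critical points: values `≥ d ≥ 8ε` away from `b`, hence `≥ 6ε` away from `b'`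
  have hold_lt : ∀ x, IsMCriticalPt (𝓡 3) φ x → φ x < b → g x < b' ∧ morseIndex (𝓡 3) g x ≤ 1 := by
    intro x hx hxb
    have h1 := hd x hx
    rw [abs_of_neg (sub_neg.2 hxb)] at h1
    refine ⟨?_, by rw [hidx x hx]; exact hbelow x hx hxb⟩
    rw [hgold x hx]
    linarith [(abs_lt.1 hb'b).1]
  have hold_gt : ∀ x, IsMCriticalPt (𝓡 3) φ x → b < φ x → b' < g x ∧ 2 ≤ morseIndex (𝓡 3) g x := by
    intro x hx hxb
    have h1 := hd x hx
    rw [abs_of_pos (sub_pos.2 hxb)] at h1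
    refine ⟨?_, by rw [hidx x hx]; exact habove x hx hxb⟩
    rw [hgold x hx]
    linarith [(abs_lt.1 hb'b).2]
  have hold_cases : ∀ x, IsMCriticalPt (𝓡 3) φ x → φ x < b ∨ b < φ x := fun x hx =>
    lt_or_gt_of_ne (hbreg x hx)
  refine ⟨g, b', hgM, fun y => ?_, fun z hz => ?_, fun z hz hzb => ?_, fun z hz hzb => ?_,
    fun y hy => hgK y fun hyK => hy (hKU hyK).1, ?_, ?_, ?_, ?_⟩
  · -- values in `(0, 1)`
    have h1 := abs_lt.1 (hclose y)
    have h2 : φ ymin ≤ φ y := hymin (mem_univ y)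
    have h3 : φ y ≤ φ ymax := hymax (mem_univ y)
    constructor <;> linarith
  · -- `b'` is not a critical value
    rcases (hmem z).1 hz with rfl | rfl | hz'
    · exact hb'q.ne
    · exact hb'r.ne'
    · rcases hold_cases z hz' with h | h
      · exact (hold_lt z hz' h).1.ne
      · exact (hold_gt z hz' h).1.ne'
  · -- below `b'`: index `≤ 1`
    rcases (hmem z).1 hz with rfl | rfl | hz'
    · omega
    · exact absurd hzb (not_lt.2 hb'r.le)
    · rcases hold_cases z hz' with h | h
      · exact (hold_lt z hz' h).2
      · exact absurd hzb (not_lt.2 (hold_gt z hz' h).1.le)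
  · -- above `b'`: index `≥ 2`
    rcases (hmem z).1 hz with rfl | rfl | hz'
    · exact absurd hzb (not_lt.2 hb'q.le)
    · omega
    · rcases hold_cases z hz' with h | h
      · exact absurd hzb (not_lt.2 (hold_lt z hz' h).1.le)
      · exact (hold_gt z hz' h).2
  · -- index `0`
    ext x
    simp only [mem_criticalSetOfIndex]
    constructor
    · rintro ⟨hx, hi⟩
      rcases (hmem x).1 hx with rfl | rfl | hx'
      · omega
      · omega
      · exact ⟨hx', by rwa [hidx x hx'] at hi⟩
    · rintro ⟨hx, hi⟩
      exact ⟨(hmem x).2 (Or.inr (Or.inr hx)), by rwa [hidx x hx]⟩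
  · -- index `3`
    ext x
    simp only [mem_criticalSetOfIndex]
    constructor
    · rintro ⟨hx, hi⟩
      rcases (hmem x).1 hx with rfl | rfl | hx'
      · omega
      · omega
      · exact ⟨hx', by rwa [hidx x hx'] at hi⟩
    · rintro ⟨hx, hi⟩
      exact ⟨(hmem x).2 (Or.inr (Or.inr hx)), by rwa [hidx x hx]⟩
  · -- index `1`: the old ones and `q`
    have heq : criticalSetOfIndex (𝓡 3) g 1 = insert q (criticalSetOfIndex (𝓡 3) φ 1) := by
      ext x
      simp only [mem_criticalSetOfIndex, mem_insert_iff]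
      constructor
      · rintro ⟨hx, hi⟩
        rcases (hmem x).1 hx with rfl | rfl | hx'
        · exact Or.inl rfl
        · omega
        · exact Or.inr ⟨hx', by rwa [hidx x hx'] at hi⟩
      · rintro (rfl | ⟨hx, hi⟩)
        · exact ⟨(hmem x).2 (Or.inl rfl), hiq⟩
        · exact ⟨(hmem x).2 (Or.inr (Or.inr hx)), by rwa [hidx x hx]⟩
    rw [heq, ncard_insert_of_notMem (fun h' => hq h'.1) (hfin.subset (criticalSetOfIndex_subset _ φ 1))]
  · -- index `2`: the old ones and `r`
    have heq : criticalSetOfIndex (𝓡 3) g 2 = insert r (criticalSetOfIndex (𝓡 3) φ 2) := by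
      ext x
      simp only [mem_criticalSetOfIndex, mem_insert_iff]
      constructor
      · rintro ⟨hx, hi⟩
        rcases (hmem x).1 hx with rfl | rfl | hx'
        · omega
        · exact Or.inl rfl
        · exact Or.inr ⟨hx', by rwa [hidx x hx'] at hi⟩
      · rintro (rfl | ⟨hx, hi⟩)
        · exact ⟨(hmem x).2 (Or.inr (Or.inl rfl)), hir⟩
        · exact ⟨(hmem x).2 (Or.inr (Or.inr hx)), by rwa [hidx x hx]⟩
    rw [heq, ncard_insert_of_notMem (fun h' => hr h'.1) (hfin.subset (criticalSetOfIndex_subset _ φ 2))]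

end Literature.Topology.FourManifolds

end
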